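import Literature.Analysis.Complex.TwoConstantsDisc
import Mathlib.Analysis.Complex.Hadamard
import Mathlib.Analysis.SpecialFunctions.Complex.Log
import HarnessLib

/-!
# ScalingDefectPeepholeDoorThreeCircles — door S30 «ScalingDefectPeepholeDoor», plate P1 (K2 `TubePropagation`), part 1/2:
# the two complex-analysis steps of the tube-propagation chain (ns-s29-p2 g2, DIRECTOR-NS #165 (1))

For a holomorphic map `g : ℂ → E` (complex Banach space `E`) on a neighbourhood of a closed disc `D̄(c, R)`:
* `norm_le_sqrt_of_small_disc` — **Hadamard three-circles, halving form**: `‖g‖ ≤ m` on `D̄(c, R/4)` and `‖g‖ ≤ K` on `D̄(c, R)`,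
  `0 < m ≤ K` ⟹ `‖g‖ ≤ √(mK)` on `D̄(c, R/2)` (Mathlib's three-LINES theorem for `ζ ↦ g(c + e^ζ)` on the strip
  `log(R/4) ≤ Re ζ ≤ log R`; the exponent at radius `R/2` is `1/2`);
* `norm_le_two_constants_of_real_diameter` — **two-constants, rescaled**: `‖g‖ ≤ K` on `D̄(c, R)` (`c` real) and `‖g‖ ≤ m` on the
  real diameter `(c − R, c + R)` ⟹ `‖g‖ ≤ m^{Λ} K^{1−Λ}` on `D̄(c, R/2)`, `Λ = 1 − (2/π)arctan(4/3) > 0`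
  (tree `TwoConstantsDisc.norm_le_two_constants_disc_of_norm_le` at `r = 1/2`).
Part 2/2 chains these along the complex line through the peephole centre and the target point inside the local tube.

WHAT THIS IS NOT: pure complex analysis; nothing about door S30, 0056 or NS regularity is proved here.
-/

noncomputable section

open Set Filter Topology Metric Complex Real

set_option linter.dupNamespace false

namespace Summit.NavierStokesRegularity.NavierStokesRegularity.Theorems.ScalingDefectPeepholeDoor

variable {E : Type*} [NormedAddCommGroup E] [NormedSpace ℂ E]

/-! ## §1 Hadamard three circles, halving form -/

/-- `t ↦ m^{1−t} K^{t}` is bounded by `m^{1/2} K^{1/2}` for `t ≤ 1/2` when `0 < m ≤ K`. -/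
theorem rpow_interp_le_half {m K t : ℝ} (hm : 0 < m) (hmK : m ≤ K) (ht : t ≤ 1 / 2) :
    m ^ (1 - t) * K ^ t ≤ m ^ ((1 : ℝ) / 2) * K ^ ((1 : ℝ) / 2) := by
  have hK : 0 < K := hm.trans_le hmK
  have hq : 1 ≤ K / m := by rw [le_div_iff₀ hm, one_mul]; exact hmK
  have hsplit : m ^ (1 - t) * K ^ t = (m ^ ((1 : ℝ) / 2) * K ^ ((1 : ℝ) / 2)) * (K / m) ^ (t - 1 / 2) := by
    rw [Real.div_rpow hK.le hm.le, show (1 : ℝ) - t = 1 / 2 + (-(t - 1 / 2)) by ring, Real.rpow_add hm,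
      Real.rpow_neg hm.le, show t = 1 / 2 + (t - 1 / 2) by ring, Real.rpow_add hK]
    have : m ^ (t - 1 / 2) ≠ 0 := (Real.rpow_pos_of_pos hm _).ne'
    field_simp
    ring_nf
  rw [hsplit]
  have hle : (K / m) ^ (t - 1 / 2) ≤ 1 := Real.rpow_le_one_of_one_le_of_nonpos hq (by linarith)
  have hpos : 0 ≤ m ^ ((1 : ℝ) / 2) * K ^ ((1 : ℝ) / 2) := by positivity
  calc (m ^ ((1 : ℝ) / 2) * K ^ ((1 : ℝ) / 2)) * (K / m) ^ (t - 1 / 2)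
      ≤ (m ^ ((1 : ℝ) / 2) * K ^ ((1 : ℝ) / 2)) * 1 := mul_le_mul_of_nonneg_left hle hpos
    _ = _ := mul_one _

/-- `√(mK) = m^{1/2} K^{1/2}`. -/
theorem sqrt_mul_eq_rpow {m K : ℝ} (hm : 0 ≤ m) (hK : 0 ≤ K) :
    Real.sqrt (m * K) = m ^ ((1 : ℝ) / 2) * K ^ ((1 : ℝ) / 2) := by
  rw [Real.sqrt_eq_rpow, Real.mul_rpow hm hK]

/-- **Hadamard three circles (halving form).**  Let `g` be complex differentiable on an open ball `B(c, R₃)`, `R < R₃`, with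
`‖g w‖ ≤ K` for `‖w − c‖ ≤ R` and `‖g w‖ ≤ m` for `‖w − c‖ ≤ R/4`, where `0 < m ≤ K`.  Then `‖g w‖ ≤ √(mK)` for `‖w − c‖ ≤ R/2`.
[three-lines theorem for `h(ζ) = g(c + exp ζ)` on the strip `log(R/4) ≤ Re ζ ≤ log R`] -/
theorem norm_le_sqrt_of_small_disc {g : ℂ → E} {c : ℂ} {R R₃ m K : ℝ} (hR : 0 < R) (hR₃ : R < R₃)
    (hg : DifferentiableOn ℂ g (ball c R₃)) (hm : 0 < m) (hmK : m ≤ K)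
    (hK : ∀ w : ℂ, ‖w - c‖ ≤ R → ‖g w‖ ≤ K) (hsmall : ∀ w : ℂ, ‖w - c‖ ≤ R / 4 → ‖g w‖ ≤ m)
    {w : ℂ} (hw : ‖w - c‖ ≤ R / 2) : ‖g w‖ ≤ Real.sqrt (m * K) := by
  by_cases hwin : ‖w - c‖ ≤ R / 4
  · refine (hsmall w hwin).trans ?_
    calc m = Real.sqrt (m * m) := (Real.sqrt_mul_self hm.le).symm
      _ ≤ Real.sqrt (m * K) := Real.sqrt_le_sqrt (mul_le_mul_of_nonneg_left hmK hm.le)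
  rw [not_le] at hwin
  -- the strip picture
  set l : ℝ := Real.log (R / 4) with hl
  set u : ℝ := Real.log R with hu
  have hR4 : 0 < R / 4 := by positivity
  have hlu : l < u := Real.log_lt_log hR4 (by linarith)
  have hul : u - l = Real.log 4 := by
    rw [hu, hl, Real.log_div hR.ne' (by norm_num)]; ring
  set h : ℂ → E := fun ζ => g (c + Complex.exp ζ) with hh
  -- points of the closed strip land in the closed annulus
  have hmem : ∀ ζ : ℂ, ζ ∈ HadamardThreeLines.verticalClosedStrip l u → ‖(c + Complex.exp ζ) - c‖ ≤ R ∧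
      R / 4 ≤ ‖(c + Complex.exp ζ) - c‖ := by
    intro ζ hζ
    rw [HadamardThreeLines.verticalClosedStrip, mem_preimage, mem_Icc] at hζ
    rw [add_sub_cancel_left, Complex.norm_exp]
    constructor
    · calc Real.exp ζ.re ≤ Real.exp u := Real.exp_le_exp.2 hζ.2
        _ = R := by rw [hu, Real.exp_log hR]
    · calc R / 4 = Real.exp l := by rw [hl, Real.exp_log hR4]
        _ ≤ Real.exp ζ.re := Real.exp_le_exp.2 hζ.1
  -- `h` is differentiable on a neighbourhood of the closed strip
  have hstripR₃ : ∀ ζ : ℂ, ζ.re < Real.log R₃ → c + Complex.exp ζ ∈ ball c R₃ := by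
    intro ζ hζ
    rw [mem_ball, dist_eq_norm, add_sub_cancel_left, Complex.norm_exp]
    calc Real.exp ζ.re < Real.exp (Real.log R₃) := Real.exp_lt_exp.2 hζ
      _ = R₃ := Real.exp_log (hR.trans hR₃)
  have hdiff : DiffContOnCl ℂ h (HadamardThreeLines.verticalStrip l u) := by
    apply DifferentiableOn.diffContOnCl
    rw [HadamardThreeLines.verticalStrip, Complex.closure_preimage_re, closure_Ioo hlu.ne]
    intro ζ hζ
    have hζ' : ζ.re < Real.log R₃ := lt_of_le_of_lt hζ.2 (by rw [hu]; exact Real.log_lt_log hR hR₃)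
    have hgd : DifferentiableAt ℂ g (c + Complex.exp ζ) :=
      (hg _ (hstripR₃ ζ hζ')).differentiableAt (isOpen_ball.mem_nhds (hstripR₃ ζ hζ'))
    exact (hgd.comp ζ ((Complex.differentiable_exp ζ).const_add c)).differentiableWithinAt
  have hbdd : BddAbove ((norm ∘ h) '' HadamardThreeLines.verticalClosedStrip l u) := by
    refine ⟨K, ?_⟩
    rintro _ ⟨ζ, hζ, rfl⟩
    exact hK _ (hmem ζ hζ).1
  have ha : ∀ ζ ∈ Complex.re ⁻¹' {l}, ‖h ζ‖ ≤ m := by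
    intro ζ hζ
    apply hsmall
    rw [add_sub_cancel_left, Complex.norm_exp, show ζ.re = l from hζ, hl, Real.exp_log hR4]
  have hb : ∀ ζ ∈ Complex.re ⁻¹' {u}, ‖h ζ‖ ≤ K := by
    intro ζ hζ
    apply hK
    rw [add_sub_cancel_left, Complex.norm_exp, show ζ.re = u from hζ, hu, Real.exp_log hR]
  -- the point `w = c + exp ζ₀`
  have hwc : w - c ≠ 0 := by
    intro h0; rw [h0, norm_zero] at hwin; linarith
  set ζ₀ : ℂ := Complex.log (w - c) with hζ₀
  have hwζ : c + Complex.exp ζ₀ = w := by rw [hζ₀, Complex.exp_log hwc]; abel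
  have hre : ζ₀.re = Real.log ‖w - c‖ := Complex.log_re _
  have hζ₀mem : ζ₀ ∈ HadamardThreeLines.verticalClosedStrip l u := by
    rw [HadamardThreeLines.verticalClosedStrip, mem_preimage, mem_Icc, hre]
    exact ⟨Real.log_le_log hR4 hwin.le, Real.log_le_log (by linarith) (hw.trans (by linarith))⟩
  have key := HadamardThreeLines.norm_le_interp_of_mem_verticalClosedStrip' hlu hζ₀mem hdiff hbdd ha hb
  simp only [hh] at key
  rw [hwζ] at key
  -- the exponent at `w` is at most `1/2`
  set t : ℝ := (ζ₀.re - l) / (u - l) with ht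
  have ht12 : t ≤ 1 / 2 := by
    rw [ht, div_le_iff₀ (by linarith), hul, hre, hl]
    have h4 : Real.log ‖w - c‖ - Real.log (R / 4) = Real.log (‖w - c‖ / (R / 4)) := by
      rw [Real.log_div (norm_pos_iff.2 hwc).ne' hR4.ne']
    rw [h4]
    have hq : ‖w - c‖ / (R / 4) ≤ 2 := by rw [div_le_iff₀ hR4]; linarith
    have hq0 : 0 < ‖w - c‖ / (R / 4) := by positivity
    calc Real.log (‖w - c‖ / (R / 4)) ≤ Real.log 2 := Real.log_le_log hq0 hq
      _ = 1 / 2 * Real.log 4 := by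
          rw [show (4 : ℝ) = 2 ^ 2 by norm_num, Real.log_pow]; ring
  calc ‖g w‖ ≤ m ^ (1 - t) * K ^ t := key
    _ ≤ m ^ ((1 : ℝ) / 2) * K ^ ((1 : ℝ) / 2) := rpow_interp_le_half hm hmK ht12
    _ = Real.sqrt (m * K) := (sqrt_mul_eq_rpow hm.le (hm.le.trans hmK)).symm

/-! ## §2 The two-constants step on a disc with a real centre -/

/-- the two-constants exponent at half radius: `Λ = 1 − (2/π)·arctan(4/3) ∈ (0, 1]`. -/
theorem twoConstantsExp_pos : 0 < 1 - 2 / π * Real.arctan (4 / 3) := by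
  have h := Real.arctan_lt_pi_div_two (4 / 3)
  have hπ := Real.pi_pos
  rw [sub_pos, div_mul_eq_mul_div, div_lt_one hπ]
  linarith

/-- `Λ ≤ 1`. -/
theorem twoConstantsExp_le_one : 1 - 2 / π * Real.arctan (4 / 3) ≤ 1 := by
  have h : 0 ≤ Real.arctan (4 / 3) := (Real.arctan_pos.2 (by norm_num)).le
  have : 0 ≤ 2 / π * Real.arctan (4 / 3) := by positivity
  linarith

/-- **two constants on a disc with real centre.**  Let `g` be complex differentiable on `B(c, R₃)` (`c ∈ ℝ`, `R < R₃`), with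
`‖g w‖ ≤ K` for `‖w − c‖ ≤ R` and `‖g x‖ ≤ m` for REAL `x ∈ (c − R, c + R)`, `0 ≤ m ≤ K`.  Then for `‖w − c‖ ≤ R/2`:
`‖g w‖ ≤ m^{Λ} K^{1−Λ}`, `Λ = 1 − (2/π)arctan(4/3)`. -/
theorem norm_le_two_constants_of_real_diameter {g : ℂ → E} {c R R₃ m K : ℝ} (hR : 0 < R) (hR₃ : R < R₃)
    (hg : DifferentiableOn ℂ g (ball (c : ℂ) R₃)) (hm0 : 0 ≤ m) (hmK : m ≤ K)
    (hK : ∀ w : ℂ, ‖w - c‖ ≤ R → ‖g w‖ ≤ K) (hm : ∀ x : ℝ, |x - c| < R → ‖g x‖ ≤ m)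
    {w : ℂ} (hw : ‖w - c‖ ≤ R / 2) :
    ‖g w‖ ≤ m ^ (1 - 2 / π * Real.arctan (4 / 3)) * K ^ (2 / π * Real.arctan (4 / 3)) := by
  -- rescale to the unit disc
  set f : ℂ → E := fun z => g (c + R * z) with hf
  have hmaps : ∀ z : ℂ, ‖z‖ ≤ 1 → ‖(c + R * z : ℂ) - c‖ ≤ R := fun z hz => by
    rw [add_sub_cancel_left, norm_mul, Complex.norm_real, Real.norm_of_nonneg hR.le]
    exact mul_le_of_le_one_right hR.le hz
  have hfd : DiffContOnCl ℂ f (ball 0 1) := by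
    apply DifferentiableOn.diffContOnCl
    rw [closure_ball (0 : ℂ) one_ne_zero]
    intro z hz
    rw [mem_closedBall, dist_zero_right] at hz
    have hin : (c + R * z : ℂ) ∈ ball (c : ℂ) R₃ := by
      rw [mem_ball, dist_eq_norm]; exact (hmaps z hz).trans_lt hR₃
    have hgd : DifferentiableAt ℂ g (c + R * z) := (hg _ hin).differentiableAt (isOpen_ball.mem_nhds hin)
    exact (hgd.comp z ((differentiableAt_id.const_mul (R : ℂ)).const_add (c : ℂ))).differentiableWithinAt
  have hM' : ∀ z : ℂ, ‖z‖ ≤ 1 → ‖f z‖ ≤ K := fun z hz => hK _ (hmaps z hz)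
  have hm' : ∀ x : ℝ, |x| < 1 → ‖f x‖ ≤ m := by
    intro x hx
    have e : (c + R * (x : ℂ) : ℂ) = ((c + R * x : ℝ) : ℂ) := by push_cast; rfl
    simp only [hf, e]
    apply hm
    rw [add_sub_cancel_left, abs_mul, abs_of_pos hR]
    calc R * |x| < R * 1 := mul_lt_mul_of_pos_left hx hR
      _ = R := mul_one R
  -- the point
  set z₀ : ℂ := (w - c) / R with hz₀
  have hz₀n : ‖z₀‖ ≤ 1 / 2 := by
    rw [hz₀, norm_div, Complex.norm_real, Real.norm_of_nonneg hR.le, div_le_iff₀ hR]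
    linarith
  have hwz : c + R * z₀ = w := by
    rw [hz₀]; field_simp [(show (R : ℂ) ≠ 0 by exact_mod_cast hR.ne')]; ring
  have key := Literature.Analysis.Complex.TwoConstantsDisc.norm_le_two_constants_disc_of_norm_le hfd hM' hm' hm0 hmK
    (by norm_num : (1 : ℝ) / 2 < 1) hz₀n
  rw [show (2 : ℝ) * (1 / 2) / (1 - (1 / 2) ^ 2) = 4 / 3 by norm_num] at key
  simpa only [hf, hwz] using key

end Summit.NavierStokesRegularity.NavierStokesRegularity.Theorems.ScalingDefectPeepholeDoor

end
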